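/-
rh-inputs cell (A1 = `Grosswald1967_thmB`), prover-3 (cell-lead ruling 07:34:23Z, 2026-08-28).
PieceA of the A1 architecture, ASSEMBLED: the counting half of the moment-method proof of Pólya's
sign-change theorem.  Nothing in this file bears on the truth of RH.
-/
import Literature.NumberTheory.LFunctions.PolyaSignChangesPieceA
import Literature.NumberTheory.LFunctions.PolyaSignChangesTruncation
import Literature.NumberTheory.LFunctions.PolyaSignChangesBlocks

/-!
# PieceA — the counting lemma of the moment method (assembled)

`pieceA : PieceA` (`PolyaSignChangesMomentDefs.PieceA`): admissible pole-pair data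
`(g, σ₁, λ, x, R', ρ, Ψ)` — `g t^{-(σ₁+1)}` integrable on `(1, ∞)`, a continuation `Ψ` of
`mellinIoi g` holomorphic on the closed disc `|s − λ| ≤ R'` except for a real-symmetric pair of
genuine poles `ρ, ρ̄` strictly inside, and the tail inequality `x e^{1 − x(λ−σ₁)/λ} |λ − ρ| < λ` —
force sign-chain density `≥ polePairRate λ x ρ = λ·arctan(γ/(λ−β))/(πx)` for `g`
(`SignChainDensity`, the limsup form of Theorem B's conclusion).

It is the one-line instantiation of the composition
`pieceA_of_truncation_of_blocks` (`PolyaSignChangesPieceA`, PLAN-A1 §6: Laguerre's rule of signs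
`laguerre_truncatedMoments` + the dichotomy "long chain or chain bound" + the `(D − c) log y`
arithmetic) with the two landed stubs of the skeleton:

* `stub_truncation` (`PolyaSignChangesTruncation`, prover-1: on the good indices the truncated moments
  have the sign of `cos((m+k)φ + α)` — pole-pair Taylor asymptotics `PolyaSignChangesPolePair*` plus
  the tail estimate `stub_tail`), and
* `stub_blocks` (`PolyaSignChangesBlocks`, prover-1: such a sign pattern yields an alternating index
  chain of length `≥ φK/π − φk₀/π − 3`).

Together with `pieceB` (`PolyaSignChangesInfiniteHeight`, prover-2) it discharges the named fact
`Grosswald1967_thmB` through `grosswald1967_thmB_of` (`PolyaSignChangesHolds`).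
-/

noncomputable section

namespace Literature.NumberTheory.LFunctions

namespace PolyaSignChanges

/-- **PieceA — the Descartes–Laguerre counting lemma.**  Admissible pole-pair data at the real point
`λ` force alternating sign chains of `g` in `(1, y]` of length `≥ c log y` for every
`c < λ·arctan(γ/(λ−β))/(πx)` and unboundedly many `y` (indeed all large `y`).  Assembled from
`stub_truncation`, `stub_blocks` and `laguerre_truncatedMoments` via `pieceA_of_truncation_of_blocks`.
[cite: Grosswald1967, §4 Theorem B (Pólya), pp. 4–5 (counting half of the moment-method proof)] -/
theorem pieceA : PieceA :=
  pieceA_of_truncation_of_blocks stub_truncation stub_blocks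

end PolyaSignChanges

end Literature.NumberTheory.LFunctions

end
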